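import Summits.CriticalPhenomena.PercolationContinuityZ3.Theorems.PercNearOneGluingNoHeavyLowerTailSahiTriangleSupermodular
import Mathlib.Tactic.Linarith
import Mathlib.Tactic.LinearCombination
import HarnessLib

/-!
# `NoHeavyLowerTail` (crux stmt-CriticalPhenomena-4575), P2 — T₁(|C|=1): the HUB TWO-LEVEL FORM is bounded below by an explicit
# z-covariance expression (`TL ≥ D₀`); the `ρ ≡ 1` case of the c-polarised ratio identity

Memo `FROM-prim-masterthm-p2-g27-POLARISED-RATIO.md` §2(d), SAHI-ROUTE.md §4.51 (seat `prim-masterthm-p2`, gen 27;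
`--supports stmt-CriticalPhenomena-4575`).  No `sorry`, no named facts, standard axioms.

SETTING (the c-polarised form of T₁(|C|=1), i.e. of Kahn's `C₃` for `f(z,c,a), g(z,c,b), h(z,a,b)`).  `Z = Fin 2` (the hub coin `z`,
weight `wZ`, `wZ 0 + wZ 1 = 1`), `α, β` finite distributive lattices with FKG probability weights `wA, wB`;
`f : Fin 2 → Fin 2 → α → ℝ` with `f i z a` = the c-section `i` (c-level) of the first member at hub level `z`, nonnegative, monotone in `a`
and in `z`, and NESTED in `i` (`f 0 z a ≤ f 1 z a`); likewise `g : Fin 2 → Fin 2 → β → ℝ`; `h : Fin 2 → α → β → ℝ` nonnegative, monotone in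
`z, a, b`.  The TWO-LEVEL FORM of the nested pair `((f₁,g₁,h),(f₀,g₀,h))` (tree `twoLevelForm` along the c-axis, idle third slot; it is twice the
middle Bernstein coefficient of `s ↦ E₃` of the T₁(|C|=1) triple at c-bias `s`, memo §0) is
  `TL = 2μ(f₀g₀h) + 2μ(f₁g₁h) − f̄₀μ(g₁h) − f̄₁μ(g₀h) − ḡ₀μ(f₁h) − ḡ₁μ(f₀h) − h̄[μ(f₀g₀)+μ(f₁g₁)] + h̄(f̄₀ḡ₁+f̄₁ḡ₀)`
(`twoLevel` below, written in the slices `Y_i(z,b) = E_a[f_i(z,a)h(z,a,b)]`, `H(z,b) = E_a h(z,a,b)`).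

**THEOREM (`twoLevel_ge_Dzero`).**  `TL ≥ D₀ := Cov_z(ḡ₀,e₀) + Cov_z(ḡ₁,e₁) + (ḡ₁−ḡ₀)·(E_z e₁ − E_z e₀)`, where `e_i(z) = Ȳ_i(z) − h̄F_i(z)`
is the SURPLUS of the pair `(f_i,h)` at hub level `z` (`E_z e_i = Cov(f_i,h)`, `ḡ_j(z) = E_b g_j(z,·)`).  Hence
**`TL ≥ 0` whenever `D₀ ≥ 0`** — e.g. whenever `h` is not negatively correlated with the c-shell `f₁ − f₀` and the surpluses `e_i` do not decrease in `z`.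

PROOF = the `ρ ≡ 1` case of the c-polarised ratio identity (memo §2): `TL = Σ_b wB(b)·Φ₁(b) + COV₁ + D₀` (`twoLevel_eq`) with
`Φ₁(b) = Σ_z wZ(z)[g₀(z,b)(Y₀(z,b) − f̄₁H(z,b)) + g₁(z,b)(Y₁(z,b) − f̄₀H(z,b))] ≥ 0` at EVERY fibre (`Phi1_nonneg`: decompose the monotone pattern
`g_j(z,b)` on the 2×2 poset into up-sets; each pattern follows from the FKG slice bound `Y_i(z,b) ≥ F_i(z)H(z,b)` on `α`, monotonicity of `F` and
`H(0,b) ≤ H(1,b)` — `pattern_nonneg`) and `COV₁ = Σ_iΣ_z wZ·Cov_b(g_i(z,·),Y_i(z,·)) ≥ 0` (FKG on `β`); the base case `σ = 0` of the LP of memo §3–§4.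

ALSO (the general form, memo §2): for an ARBITRARY ratio `ρ : Fin 2 → Fin 2 → ℝ` the **c-POLARISED RATIO IDENTITY** `twoLevel_eq_ratio`
  `TL = Σ_b wB(b)Φ_B(b) + COV(ρ) + DELTA(ρ)`
(`PhiB`, `CovR`, `DeltaR`; `ψ_i(z) = h̄F_i(z) − ρ_i(z)Ȳ_i(z)`; it is the middle s-coefficient of the ratio identity of `…SahiSharedTwoPointIdentity`
on the (z,c)-diamond with s-free ratios), `CovR_nonneg` (`COV(ρ) ≥ 0` for `ρ ∈ [0,1]`, FKG on `β`), and the CERTIFICATE FORM `twoLevel_nonneg_of_ratio`: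
`TL ≥ 0` as soon as some `ρ ∈ [0,1]^{2×2}` has `Φ_B(b) ≥ 0` at every fibre and `DELTA(ρ) ≥ 0`.  Memo §3–§4: such a `ρ` exists in every one of
≈ 2 700 sampled cells and at every sampled point of the 15-dimensional environment polytope (the finite-dimensional statement (ENV-LP) that now
carries T₁(|C|=1)).  HONEST LABEL: a face of T₁(|C|=1) (`D₀ ≥ 0` holds in ≈ 85 % of sampled cells) plus a certificate frame; `C₃`, T₁, T₁(|C|=1) OPEN.
-/

noncomputable section

open scoped Classical
namespace Summit.CriticalPhenomena.PercolationContinuityZ3.Theorems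
namespace SahiHubTwoLevel
open Finset Literature.Combinatorics.Sahi2008
open SahiTriangleSupermodular (fkg_sum)
section Defs
variable {α β : Type} [Fintype α] [Fintype β]
  (wA : α → ℝ) (wB : β → ℝ) (wZ : Fin 2 → ℝ) (f : Fin 2 → Fin 2 → α → ℝ) (g : Fin 2 → Fin 2 → β → ℝ) (h : Fin 2 → α → β → ℝ)
/-- Slice `Y_i(z,b) = E_a[f_i(z,a) h(z,a,b)]`. [this work] -/
def Ysl (i z : Fin 2) (b : β) : ℝ := ∑ a, wA a * (f i z a * h z a b)
/-- Slice `H(z,b) = E_a h(z,a,b)`. [this work] -/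
def Hsl (z : Fin 2) (b : β) : ℝ := ∑ a, wA a * h z a b
/-- Section mean `F_i(z) = E_a f_i(z,a)`. [this work] -/
def Fm (i z : Fin 2) : ℝ := ∑ a, wA a * f i z a
/-- Section mean `ḡ_j(z) = E_b g_j(z,b)`. [this work] -/
def gm (j z : Fin 2) : ℝ := ∑ b, wB b * g j z b
/-- Slice mass `Ȳ_i(z) = E_b Y_i(z,b) = E[f_i h | z]`. [this work] -/
def Ybar (i z : Fin 2) : ℝ := ∑ b, wB b * Ysl wA f h i z b
/-- Level mean of `h`: `H̄(z) = E_b H(z,b)`. [this work] -/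
def Hb (z : Fin 2) : ℝ := ∑ b, wB b * Hsl wA h z b
/-- `S^{gY}_{ij}(z) = E_b[g_j(z,b) Y_i(z,b)] = E[f_i g_j h | z]`. [this work] -/
def Sgy (i j z : Fin 2) : ℝ := ∑ b, wB b * (g j z b * Ysl wA f h i z b)
/-- `S^{gH}_j(z) = E_b[g_j(z,b) H(z,b)] = E[g_j h | z]`. [this work] -/
def Sgh (j z : Fin 2) : ℝ := ∑ b, wB b * (g j z b * Hsl wA h z b)
/-- Global mean `f̄_i = E_z F_i(z)`. [this work] -/
def fbar (i : Fin 2) : ℝ := ∑ z, wZ z * Fm wA f i z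
/-- Global mean `ḡ_j = E_z ḡ_j(z)`. [this work] -/
def gbar (j : Fin 2) : ℝ := ∑ z, wZ z * gm wB g j z
/-- Global mean `h̄ = E_z H̄(z)`. [this work] -/
def hbar : ℝ := ∑ z, wZ z * Hb wA wB h z
/-- Surplus `e_i(z) = Ȳ_i(z) − h̄ F_i(z)` of the pair `(f_i, h)` at hub level `z`. [this work] -/
def surplus (i z : Fin 2) : ℝ := Ybar wA wB f h i z - hbar wA wB wZ h * Fm wA f i z
/-- **The hub two-level form** `TL = 2μ(f₀g₀h)+2μ(f₁g₁h) − f̄₀μ(g₁h) − f̄₁μ(g₀h) − ḡ₀μ(f₁h) − ḡ₁μ(f₀h) − h̄[μ(f₀g₀)+μ(f₁g₁)] + h̄(f̄₀ḡ₁+f̄₁ḡ₀)`,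
all moments written through the hub level `z` (`μ(f_ig_jh) = E_z S^{gY}_{ij}`, `μ(f_ig_i) = E_z[F_i ḡ_i]`, …). [this work] -/
def twoLevel : ℝ :=
  2 * (∑ z, wZ z * Sgy wA wB f g h 0 0 z) + 2 * (∑ z, wZ z * Sgy wA wB f g h 1 1 z)
    - fbar wA wZ f 0 * (∑ z, wZ z * Sgh wA wB g h 1 z) - fbar wA wZ f 1 * (∑ z, wZ z * Sgh wA wB g h 0 z)
    - gbar wB wZ g 0 * (∑ z, wZ z * Ybar wA wB f h 1 z) - gbar wB wZ g 1 * (∑ z, wZ z * Ybar wA wB f h 0 z)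
    - hbar wA wB wZ h * ((∑ z, wZ z * (Fm wA f 0 z * gm wB g 0 z)) + ∑ z, wZ z * (Fm wA f 1 z * gm wB g 1 z))
    + hbar wA wB wZ h * (fbar wA wZ f 0 * gbar wB wZ g 1 + fbar wA wZ f 1 * gbar wB wZ g 0)
/-- The pointwise kernel `Φ₁(b) = Σ_z wZ(z)[g₀(z,b)(Y₀(z,b) − f̄₁H(z,b)) + g₁(z,b)(Y₁(z,b) − f̄₀H(z,b))]` (ratio `ρ ≡ 1`). [this work] -/
def Phi1 (b : β) : ℝ :=
  ∑ z, wZ z * (g 0 z b * (Ysl wA f h 0 z b - fbar wA wZ f 1 * Hsl wA h z b) + g 1 z b * (Ysl wA f h 1 z b - fbar wA wZ f 0 * Hsl wA h z b))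
/-- The slice-covariance part `COV₁ = Σ_i Σ_z wZ(z)·Cov_b(g_i(z,·), Y_i(z,·))`. [this work] -/
def Cov1 : ℝ := ∑ i, ∑ z, wZ z * (Sgy wA wB f g h i i z - gm wB g i z * Ybar wA wB f h i z)
/-- The z-covariance remainder `D₀ = Cov_z(ḡ₀,e₀) + Cov_z(ḡ₁,e₁) + (ḡ₁ − ḡ₀)(E_z e₁ − E_z e₀)`. [this work] -/
def Dzero : ℝ :=
  (∑ i, ((∑ z, wZ z * (gm wB g i z * surplus wA wB wZ f h i z)) - gbar wB wZ g i * ∑ z, wZ z * surplus wA wB wZ f h i z))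
    + (gbar wB wZ g 1 - gbar wB wZ g 0) * ((∑ z, wZ z * surplus wA wB wZ f h 1 z) - ∑ z, wZ z * surplus wA wB wZ f h 0 z)
/-- z-average of the second member at a fibre: `G_j(b) = E_z g_j(z,b)`. [this work] -/
def Gfun (j : Fin 2) (b : β) : ℝ := ∑ z, wZ z * g j z b
/-- `S^{GY}_{ji}(z) = E_b[G_j(b) Y_i(z,b)]`. [this work] -/
def SGy (j i z : Fin 2) : ℝ := ∑ b, wB b * (Gfun wZ g j b * Ysl wA f h i z b)
variable (ρ : Fin 2 → Fin 2 → ℝ)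
/-- Deficit `ψ_i(z) = h̄F_i(z) − ρ_i(z)Ȳ_i(z)` of the pair `(f_i,h)` at hub level `z` for the ratio `ρ`. [this work] -/
def psiR (i z : Fin 2) : ℝ := hbar wA wB wZ h * Fm wA f i z - ρ i z * Ybar wA wB f h i z
/-- The pointwise kernel of the c-POLARISED RATIO IDENTITY (memo §2):
`Φ_B(b) = Σ_z wZ[g₀((2−ρ₀)Y₀ − f̄₁H) + g₁((2−ρ₁)Y₁ − f̄₀H)](z,b) − G₀(b)Σ_z wZ(1−ρ₁)Y₁(z,b) − G₁(b)Σ_z wZ(1−ρ₀)Y₀(z,b)`. [this work] -/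
def PhiB (b : β) : ℝ :=
  (∑ z, wZ z * (g 0 z b * ((2 - ρ 0 z) * Ysl wA f h 0 z b - fbar wA wZ f 1 * Hsl wA h z b)
      + g 1 z b * ((2 - ρ 1 z) * Ysl wA f h 1 z b - fbar wA wZ f 0 * Hsl wA h z b)))
    - Gfun wZ g 0 b * (∑ z, wZ z * ((1 - ρ 1 z) * Ysl wA f h 1 z b))
    - Gfun wZ g 1 b * (∑ z, wZ z * ((1 - ρ 0 z) * Ysl wA f h 0 z b))
/-- The slice-covariance part `COV(ρ) = Σ_i Σ_z wZ[ρ_i Cov_b(g_i(z,·),Y_i(z,·)) + (1−ρ_i) Cov_b(G_{1−i},Y_i(z,·))]`. [this work] -/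
def CovR : ℝ :=
  ∑ z, wZ z * (ρ 0 z * (Sgy wA wB f g h 0 0 z - gm wB g 0 z * Ybar wA wB f h 0 z)
      + (1 - ρ 0 z) * (SGy wA wB wZ f g h 1 0 z - gbar wB wZ g 1 * Ybar wA wB f h 0 z)
      + ρ 1 z * (Sgy wA wB f g h 1 1 z - gm wB g 1 z * Ybar wA wB f h 1 z)
      + (1 - ρ 1 z) * (SGy wA wB wZ f g h 0 1 z - gbar wB wZ g 0 * Ybar wA wB f h 1 z))
/-- The z-part `DELTA(ρ) = −Cov_z(ḡ₀,ψ₀) − Cov_z(ḡ₁,ψ₁) − (ḡ₁−ḡ₀)·E_z(ψ₁−ψ₀)` (the middle s-coefficient of TOPHEAVY on the (z,c)-diamond). [this work] -/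
def DeltaR : ℝ :=
  -((∑ z, wZ z * (gm wB g 0 z * psiR wA wB wZ f h ρ 0 z)) - gbar wB wZ g 0 * ∑ z, wZ z * psiR wA wB wZ f h ρ 0 z)
    - ((∑ z, wZ z * (gm wB g 1 z * psiR wA wB wZ f h ρ 1 z)) - gbar wB wZ g 1 * ∑ z, wZ z * psiR wA wB wZ f h ρ 1 z)
    - (gbar wB wZ g 1 - gbar wB wZ g 0) * ((∑ z, wZ z * psiR wA wB wZ f h ρ 1 z) - ∑ z, wZ z * psiR wA wB wZ f h ρ 0 z)
end Defs
section Main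
variable {α β : Type} [Fintype α] [Fintype β]
  {wA : α → ℝ} {wB : β → ℝ} {wZ : Fin 2 → ℝ} {f : Fin 2 → Fin 2 → α → ℝ} {g : Fin 2 → Fin 2 → β → ℝ} {h : Fin 2 → α → β → ℝ}
/-! ### The identity -/
omit [Fintype β] in
/-- `Σ_b wB Φ₁(b)` in the level moments: `= μ(f₀g₀h) + μ(f₁g₁h) − f̄₁μ(g₀h) − f̄₀μ(g₁h)`. [this work] -/
theorem sum_Phi1 (s : Finset β) :
    (∑ b ∈ s, wB b * Phi1 wA wZ f g h b) =
      wZ 0 * (∑ b ∈ s, wB b * (g 0 0 b * Ysl wA f h 0 0 b)) + wZ 1 * (∑ b ∈ s, wB b * (g 0 1 b * Ysl wA f h 0 1 b))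
      + wZ 0 * (∑ b ∈ s, wB b * (g 1 0 b * Ysl wA f h 1 0 b)) + wZ 1 * (∑ b ∈ s, wB b * (g 1 1 b * Ysl wA f h 1 1 b))
      - fbar wA wZ f 1 * (wZ 0 * (∑ b ∈ s, wB b * (g 0 0 b * Hsl wA h 0 b)) + wZ 1 * ∑ b ∈ s, wB b * (g 0 1 b * Hsl wA h 1 b))
      - fbar wA wZ f 0 * (wZ 0 * (∑ b ∈ s, wB b * (g 1 0 b * Hsl wA h 0 b)) + wZ 1 * ∑ b ∈ s, wB b * (g 1 1 b * Hsl wA h 1 b)) := by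
  induction s using Finset.induction_on with
  | empty => simp
  | insert a s ha ih =>
    simp only [sum_insert ha]
    have e : Phi1 wA wZ f g h a = wZ 0 * (g 0 0 a * (Ysl wA f h 0 0 a - fbar wA wZ f 1 * Hsl wA h 0 a)
        + g 1 0 a * (Ysl wA f h 1 0 a - fbar wA wZ f 0 * Hsl wA h 0 a))
        + wZ 1 * (g 0 1 a * (Ysl wA f h 0 1 a - fbar wA wZ f 1 * Hsl wA h 1 a)
        + g 1 1 a * (Ysl wA f h 1 1 a - fbar wA wZ f 0 * Hsl wA h 1 a)) := by
      unfold Phi1; rw [Fin.sum_univ_two]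
    rw [e]
    linear_combination ih
/-- **THE IDENTITY** `TL = Σ_b wB(b)Φ₁(b) + COV₁ + D₀` (pure bookkeeping; no hypothesis on the weights). [this work] -/
theorem twoLevel_eq :
    twoLevel wA wB wZ f g h = (∑ b, wB b * Phi1 wA wZ f g h b) + Cov1 wA wB wZ f g h + Dzero wA wB wZ f g h := by
  rw [sum_Phi1]
  unfold twoLevel Cov1 Dzero surplus fbar gbar hbar Sgy Sgh
  simp only [Fin.sum_univ_two]
  ring
/-! ### Positivity of the pieces -/
/-- The five-pattern inequality (abstract reals).  With `c₀z = w_z(Y₀z − f̄₁H_z)`, `c₁z = w_z(Y₁z − f̄₀H_z)`, `f̄_i = w₀F_{i0} + w₁F_{i1}`: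
`a·c₀₀ + b·c₀₁ + c·c₁₀ + d·c₁₁ ≥ 0` for every monotone nonnegative `(a,b,c,d) = (g₀₀,g₀₁,g₁₀,g₁₁)` on the 2×2 poset, given the FKG slice
bounds `Y_{iz} ≥ F_{iz}H_z`, `F` monotone in both indices, `0 ≤ H₀ ≤ H₁`, `w₀,w₁ ≥ 0`, `w₀+w₁ = 1`. [this work] -/
theorem pattern_nonneg (w0 w1 F00 F01 F10 F11 Y00 Y01 Y10 Y11 H0 H1 a b c d : ℝ)
    (hw0 : 0 ≤ w0) (hw1 : 0 ≤ w1) (hw : w0 + w1 = 1)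
    (hY00 : F00 * H0 ≤ Y00) (hY01 : F01 * H1 ≤ Y01) (hY10 : F10 * H0 ≤ Y10) (hY11 : F11 * H1 ≤ Y11)
    (hF0 : F00 ≤ F10) (hF1 : F01 ≤ F11) (hFz0 : F00 ≤ F01) (hFz1 : F10 ≤ F11)
    (hH : H0 ≤ H1) (hH0 : 0 ≤ H0)
    (ha : 0 ≤ a) (hab : a ≤ b) (hac : a ≤ c) (hbd : b ≤ d) (hcd : c ≤ d) :
    0 ≤ w0 * (a * (Y00 - (w0 * F10 + w1 * F11) * H0) + c * (Y10 - (w0 * F00 + w1 * F01) * H0))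
      + w1 * (b * (Y01 - (w0 * F10 + w1 * F11) * H1) + d * (Y11 - (w0 * F00 + w1 * F01) * H1)) := by
  have hw1' : w1 = 1 - w0 := by linarith
  subst hw1'
  have hH1 : 0 ≤ H1 := le_trans hH0 hH
  -- slack variables
  have s00 := sub_nonneg.2 hY00; have s01 := sub_nonneg.2 hY01; have s10 := sub_nonneg.2 hY10; have s11 := sub_nonneg.2 hY11
  -- the four cell values
  set c00 := w0 * (Y00 - (w0 * F10 + (1 - w0) * F11) * H0) with hc00
  set c01 := (1 - w0) * (Y01 - (w0 * F10 + (1 - w0) * F11) * H1) with hc01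
  set c10 := w0 * (Y10 - (w0 * F00 + (1 - w0) * F01) * H0) with hc10
  set c11 := (1 - w0) * (Y11 - (w0 * F00 + (1 - w0) * F01) * H1) with hc11
  -- the five pattern sums are nonnegative
  have L0001 : 0 ≤ c11 := by
    have e : c11 = (1 - w0) * (Y11 - F11 * H1) + (1 - w0) * H1 * (F11 - F01) + (1 - w0) * H1 * w0 * (F01 - F00) := by
      rw [hc11]; ring
    rw [e]
    have := mul_nonneg hw1 s11
    have := mul_nonneg (mul_nonneg hw1 hH1) (sub_nonneg.2 hF1)
    have := mul_nonneg (mul_nonneg (mul_nonneg hw1 hH1) hw0) (sub_nonneg.2 hFz0)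
    linarith
  have L0011 : 0 ≤ c10 + c11 := by
    have e : c10 + c11 = w0 * (Y10 - F10 * H0) + (1 - w0) * (Y11 - F11 * H1) + w0 * H0 * (F10 - F00)
        + (1 - w0) * H1 * (F11 - F01) + w0 * (1 - w0) * (F01 - F00) * (H1 - H0) := by
      rw [hc10, hc11]; ring
    rw [e]
    have := mul_nonneg hw0 s10; have := mul_nonneg hw1 s11
    have := mul_nonneg (mul_nonneg hw0 hH0) (sub_nonneg.2 hF0)
    have := mul_nonneg (mul_nonneg hw1 hH1) (sub_nonneg.2 hF1)
    have := mul_nonneg (mul_nonneg (mul_nonneg hw0 hw1) (sub_nonneg.2 hFz0)) (sub_nonneg.2 hH)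
    linarith
  have L0101 : 0 ≤ c01 + c11 := by
    have e : c01 + c11 = (1 - w0) * (Y01 - F01 * H1) + (1 - w0) * (Y11 - F11 * H1)
        + (1 - w0) * H1 * w0 * (F01 - F00) + (1 - w0) * H1 * w0 * (F11 - F10) := by
      rw [hc01, hc11]; ring
    rw [e]
    have := mul_nonneg hw1 s01; have := mul_nonneg hw1 s11
    have := mul_nonneg (mul_nonneg (mul_nonneg hw1 hH1) hw0) (sub_nonneg.2 hFz0)
    have := mul_nonneg (mul_nonneg (mul_nonneg hw1 hH1) hw0) (sub_nonneg.2 hFz1)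
    linarith
  have L0111 : 0 ≤ c01 + c10 + c11 := by
    -- c01+c10+c11 ≥ (1-w0) H1 X + w0 H0 Yc with X ≥ 0 and (1-w0) X + w0 Yc ≥ 0... organised as explicit nonnegative pieces
    have e : c01 + c10 + c11 = (1 - w0) * (Y01 - F01 * H1) + w0 * (Y10 - F10 * H0) + (1 - w0) * (Y11 - F11 * H1)
        + (1 - w0) * (H1 - H0) * (w0 * (F01 - F00) + w0 * (F11 - F10))
        + H0 * (w0 * (F10 - F00) + w0 * (1 - w0) * (F11 - F10)) := by
      rw [hc01, hc10, hc11]; ring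
    rw [e]
    have := mul_nonneg hw1 s01; have := mul_nonneg hw0 s10; have := mul_nonneg hw1 s11
    have hX : 0 ≤ w0 * (F01 - F00) + w0 * (F11 - F10) :=
      add_nonneg (mul_nonneg hw0 (sub_nonneg.2 hFz0)) (mul_nonneg hw0 (sub_nonneg.2 hFz1))
    have := mul_nonneg (mul_nonneg hw1 (sub_nonneg.2 hH)) hX
    have hY : 0 ≤ w0 * (F10 - F00) + w0 * (1 - w0) * (F11 - F10) :=
      add_nonneg (mul_nonneg hw0 (sub_nonneg.2 hF0)) (mul_nonneg (mul_nonneg hw0 hw1) (sub_nonneg.2 hFz1))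
    have := mul_nonneg hH0 hY
    linarith
  have L1111 : 0 ≤ c00 + c01 + c10 + c11 := by
    have e : c00 + c01 + c10 + c11 = w0 * (Y00 - F00 * H0) + (1 - w0) * (Y01 - F01 * H1) + w0 * (Y10 - F10 * H0)
        + (1 - w0) * (Y11 - F11 * H1) + w0 * (1 - w0) * (H1 - H0) * ((F01 - F00) + (F11 - F10)) := by
      rw [hc00, hc01, hc10, hc11]; ring
    rw [e]
    have := mul_nonneg hw0 s00; have := mul_nonneg hw1 s01; have := mul_nonneg hw0 s10; have := mul_nonneg hw1 s11
    have := mul_nonneg (mul_nonneg (mul_nonneg hw0 hw1) (sub_nonneg.2 hH))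
      (add_nonneg (sub_nonneg.2 hFz0) (sub_nonneg.2 hFz1))
    linarith
  -- decompose the monotone pattern (a,b,c,d) into up-set indicators of the 2×2 poset
  have hd : a ≤ d := le_trans hab hbd
  rcases le_total b c with hbc | hcb
  · -- a·1111 + (b−a)·0111 + (c−b)·0011 + (d−c)·0001
    have e : w0 * (a * (Y00 - (w0 * F10 + (1 - w0) * F11) * H0) + c * (Y10 - (w0 * F00 + (1 - w0) * F01) * H0))
        + (1 - w0) * (b * (Y01 - (w0 * F10 + (1 - w0) * F11) * H1) + d * (Y11 - (w0 * F00 + (1 - w0) * F01) * H1))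
        = a * (c00 + c01 + c10 + c11) + (b - a) * (c01 + c10 + c11) + (c - b) * (c10 + c11) + (d - c) * c11 := by
      rw [hc00, hc01, hc10, hc11]; ring
    rw [e]
    have := mul_nonneg ha L1111; have := mul_nonneg (sub_nonneg.2 hab) L0111
    have := mul_nonneg (sub_nonneg.2 hbc) L0011; have := mul_nonneg (sub_nonneg.2 hcd) L0001
    linarith
  · -- a·1111 + (c−a)·0111 + (b−c)·0101 + (d−b)·0001
    have e : w0 * (a * (Y00 - (w0 * F10 + (1 - w0) * F11) * H0) + c * (Y10 - (w0 * F00 + (1 - w0) * F01) * H0))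
        + (1 - w0) * (b * (Y01 - (w0 * F10 + (1 - w0) * F11) * H1) + d * (Y11 - (w0 * F00 + (1 - w0) * F01) * H1))
        = a * (c00 + c01 + c10 + c11) + (c - a) * (c01 + c10 + c11) + (b - c) * (c01 + c11) + (d - b) * c11 := by
      rw [hc00, hc01, hc10, hc11]; ring
    rw [e]
    have := mul_nonneg ha L1111; have := mul_nonneg (sub_nonneg.2 hac) L0111
    have := mul_nonneg (sub_nonneg.2 hcb) L0101; have := mul_nonneg (sub_nonneg.2 hbd) L0001
    linarith
omit [Fintype β] in
/-- **`Φ₁(b) ≥ 0` for every fibre `b`** (FKG slice bound on `α`, monotonicity, and `pattern_nonneg`). [this work] -/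
theorem Phi1_nonneg [DistribLattice α] (hA : IsFKGMeasure wA) (hZ0 : 0 ≤ wZ 0) (hZ1 : 0 ≤ wZ 1) (hZ : wZ 0 + wZ 1 = 1)
    (hf0 : ∀ i z a, 0 ≤ f i z a) (hfa : ∀ i z, Monotone (f i z)) (hfz : ∀ i a, f i 0 a ≤ f i 1 a) (hfi : ∀ z a, f 0 z a ≤ f 1 z a)
    (hg0 : ∀ j z b, 0 ≤ g j z b) (hgz : ∀ j b, g j 0 b ≤ g j 1 b) (hgi : ∀ z b, g 0 z b ≤ g 1 z b)
    (hh0 : ∀ z a b, 0 ≤ h z a b) (hha : ∀ z b, Monotone (fun a => h z a b)) (hhz : ∀ a b, h 0 a b ≤ h 1 a b) (b : β) :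
    0 ≤ Phi1 wA wZ f g h b := by
  have hA0 := hA.nonneg
  -- slice bounds Y_{iz}(b) ≥ F_i(z) H(z,b)
  have hY : ∀ i z, Fm wA f i z * Hsl wA h z b ≤ Ysl wA f h i z b := fun i z => by
    unfold Fm Hsl Ysl
    exact fkg_sum hA (hf0 i z) (fun a => hh0 z a b) (hfa i z) (hha z b)
  have hFi : ∀ z, Fm wA f 0 z ≤ Fm wA f 1 z := fun z =>
    sum_le_sum fun a _ => mul_le_mul_of_nonneg_left (hfi z a) (hA0 a)
  have hFz : ∀ i, Fm wA f i 0 ≤ Fm wA f i 1 := fun i =>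
    sum_le_sum fun a _ => mul_le_mul_of_nonneg_left (hfz i a) (hA0 a)
  have hHz : Hsl wA h 0 b ≤ Hsl wA h 1 b := sum_le_sum fun a _ => mul_le_mul_of_nonneg_left (hhz a b) (hA0 a)
  have hH0 : 0 ≤ Hsl wA h 0 b := sum_nonneg fun a _ => mul_nonneg (hA0 a) (hh0 0 a b)
  have key := pattern_nonneg (wZ 0) (wZ 1) (Fm wA f 0 0) (Fm wA f 0 1) (Fm wA f 1 0) (Fm wA f 1 1)
    (Ysl wA f h 0 0 b) (Ysl wA f h 0 1 b) (Ysl wA f h 1 0 b) (Ysl wA f h 1 1 b) (Hsl wA h 0 b) (Hsl wA h 1 b)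
    (g 0 0 b) (g 0 1 b) (g 1 0 b) (g 1 1 b) hZ0 hZ1 hZ (hY 0 0) (hY 0 1) (hY 1 0) (hY 1 1)
    (hFi 0) (hFi 1) (hFz 0) (hFz 1) hHz hH0 (hg0 0 0 b) (hgz 0 b) (hgi 0 b) (hgi 1 b) (hgz 1 b)
  have e : Phi1 wA wZ f g h b =
      wZ 0 * (g 0 0 b * (Ysl wA f h 0 0 b - (wZ 0 * Fm wA f 1 0 + wZ 1 * Fm wA f 1 1) * Hsl wA h 0 b)
        + g 1 0 b * (Ysl wA f h 1 0 b - (wZ 0 * Fm wA f 0 0 + wZ 1 * Fm wA f 0 1) * Hsl wA h 0 b))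
      + wZ 1 * (g 0 1 b * (Ysl wA f h 0 1 b - (wZ 0 * Fm wA f 1 0 + wZ 1 * Fm wA f 1 1) * Hsl wA h 1 b)
        + g 1 1 b * (Ysl wA f h 1 1 b - (wZ 0 * Fm wA f 0 0 + wZ 1 * Fm wA f 0 1) * Hsl wA h 1 b)) := by
    unfold Phi1 fbar; simp only [Fin.sum_univ_two]
  rw [e]; exact key
omit [Fintype β] in
/-- The slices `Y_i(z,·)` are monotone in `b` (for `wA, f ≥ 0`, `h` monotone in `b`). [this work] -/
theorem Ysl_mono [Preorder β] (hA0 : ∀ a, 0 ≤ wA a) (hf0 : ∀ i z a, 0 ≤ f i z a)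
    (hhb : ∀ z a, Monotone (fun b => h z a b)) (i z : Fin 2) : Monotone (Ysl wA f h i z) := by
  intro b b' hbb
  unfold Ysl
  exact sum_le_sum fun a _ => mul_le_mul_of_nonneg_left (mul_le_mul_of_nonneg_left (hhb z a hbb) (hf0 i z a)) (hA0 a)
/-- **`COV₁ ≥ 0`** (FKG on `β`: `g_i(z,·)` and `Y_i(z,·)` are monotone nonnegative). [this work] -/
theorem Cov1_nonneg [DistribLattice β] (hB : IsFKGMeasure wB) (hA0 : ∀ a, 0 ≤ wA a) (hZ : ∀ z, 0 ≤ wZ z)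
    (hf0 : ∀ i z a, 0 ≤ f i z a) (hg0 : ∀ j z b, 0 ≤ g j z b) (hgb : ∀ j z, Monotone (g j z))
    (hh0 : ∀ z a b, 0 ≤ h z a b) (hhb : ∀ z a, Monotone (fun b => h z a b)) :
    0 ≤ Cov1 wA wB wZ f g h := by
  unfold Cov1
  refine sum_nonneg fun i _ => sum_nonneg fun z _ => mul_nonneg (hZ z) (sub_nonneg.2 ?_)
  unfold Sgy gm Ybar
  exact fkg_sum hB (hg0 i z) (fun b => sum_nonneg fun a _ => mul_nonneg (hA0 a) (mul_nonneg (hf0 i z a) (hh0 z a b)))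
    (hgb i z) (Ysl_mono hA0 hf0 hhb i z)
/-! ### The theorem -/
/-- **THEOREM (`TL ≥ D₀`).**  For nested monotone nonnegative hub data on FKG blocks `α, β` and a two-point hub weight `wZ`, the two-level form is
bounded below by the explicit z-covariance expression `D₀ = Cov_z(ḡ₀,e₀) + Cov_z(ḡ₁,e₁) + (ḡ₁−ḡ₀)(E_z e₁ − E_z e₀)`;
in particular `TL ≥ 0` whenever `D₀ ≥ 0` (an explicit face of T₁(|C|=1)). [this work] -/
theorem twoLevel_ge_Dzero [DistribLattice α] [DistribLattice β] (hA : IsFKGMeasure wA) (hB : IsFKGMeasure wB)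
    (hZ0 : 0 ≤ wZ 0) (hZ1 : 0 ≤ wZ 1) (hZ : wZ 0 + wZ 1 = 1)
    (hf0 : ∀ i z a, 0 ≤ f i z a) (hfa : ∀ i z, Monotone (f i z)) (hfz : ∀ i a, f i 0 a ≤ f i 1 a) (hfi : ∀ z a, f 0 z a ≤ f 1 z a)
    (hg0 : ∀ j z b, 0 ≤ g j z b) (hgb : ∀ j z, Monotone (g j z)) (hgz : ∀ j b, g j 0 b ≤ g j 1 b) (hgi : ∀ z b, g 0 z b ≤ g 1 z b)
    (hh0 : ∀ z a b, 0 ≤ h z a b) (hha : ∀ z b, Monotone (fun a => h z a b)) (hhb : ∀ z a, Monotone (fun b => h z a b))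
    (hhz : ∀ a b, h 0 a b ≤ h 1 a b) :
    Dzero wA wB wZ f g h ≤ twoLevel wA wB wZ f g h := by
  rw [twoLevel_eq]
  have hZ' : ∀ z, 0 ≤ wZ z := fun z => by fin_cases z <;> assumption
  have h1 : 0 ≤ ∑ b, wB b * Phi1 wA wZ f g h b :=
    sum_nonneg fun b _ => mul_nonneg (hB.nonneg b) (Phi1_nonneg hA hZ0 hZ1 hZ hf0 hfa hfz hfi hg0 hgz hgi hh0 hha hhz b)
  have h2 := Cov1_nonneg (wZ := wZ) (f := f) hB hA.nonneg hZ' hf0 hg0 hgb hh0 hhb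
  linarith
/-! ### The c-polarised ratio identity for an ARBITRARY ratio `ρ_i(z)` and the certificate form of `TL ≥ 0` -/
variable {ρ : Fin 2 → Fin 2 → ℝ}
omit [Fintype β] in
/-- `Σ_b wB G_j(b) X(b)` split over the hub levels. [this work] -/
theorem sum_Gfun_mul (j : Fin 2) (X : β → ℝ) (s : Finset β) :
    (∑ b ∈ s, wB b * (Gfun wZ g j b * X b)) = wZ 0 * (∑ b ∈ s, wB b * (g j 0 b * X b)) + wZ 1 * ∑ b ∈ s, wB b * (g j 1 b * X b) := by
  induction s using Finset.induction_on with
  | empty => simp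
  | insert a s ha ih =>
    simp only [sum_insert ha]
    have e : Gfun wZ g j a = wZ 0 * g j 0 a + wZ 1 * g j 1 a := by unfold Gfun; rw [Fin.sum_univ_two]
    rw [e]; linear_combination ih
omit [Fintype β] in
/-- `Σ_b wB Φ_B(b)` in the level moments. [this work] -/
theorem sum_PhiB (s : Finset β) :
    (∑ b ∈ s, wB b * PhiB wA wZ f g h ρ b) =
      wZ 0 * ((2 - ρ 0 0) * (∑ b ∈ s, wB b * (g 0 0 b * Ysl wA f h 0 0 b)) - fbar wA wZ f 1 * (∑ b ∈ s, wB b * (g 0 0 b * Hsl wA h 0 b))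
        + (2 - ρ 1 0) * (∑ b ∈ s, wB b * (g 1 0 b * Ysl wA f h 1 0 b)) - fbar wA wZ f 0 * (∑ b ∈ s, wB b * (g 1 0 b * Hsl wA h 0 b)))
      + wZ 1 * ((2 - ρ 0 1) * (∑ b ∈ s, wB b * (g 0 1 b * Ysl wA f h 0 1 b)) - fbar wA wZ f 1 * (∑ b ∈ s, wB b * (g 0 1 b * Hsl wA h 1 b))
        + (2 - ρ 1 1) * (∑ b ∈ s, wB b * (g 1 1 b * Ysl wA f h 1 1 b)) - fbar wA wZ f 0 * (∑ b ∈ s, wB b * (g 1 1 b * Hsl wA h 1 b)))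
      - (wZ 0 * (1 - ρ 1 0) * (∑ b ∈ s, wB b * (Gfun wZ g 0 b * Ysl wA f h 1 0 b))
          + wZ 1 * (1 - ρ 1 1) * (∑ b ∈ s, wB b * (Gfun wZ g 0 b * Ysl wA f h 1 1 b)))
      - (wZ 0 * (1 - ρ 0 0) * (∑ b ∈ s, wB b * (Gfun wZ g 1 b * Ysl wA f h 0 0 b))
          + wZ 1 * (1 - ρ 0 1) * (∑ b ∈ s, wB b * (Gfun wZ g 1 b * Ysl wA f h 0 1 b))) := by
  induction s using Finset.induction_on with
  | empty => simp
  | insert a s ha ih =>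
    simp only [sum_insert ha]
    have e : PhiB wA wZ f g h ρ a =
        (wZ 0 * (g 0 0 a * ((2 - ρ 0 0) * Ysl wA f h 0 0 a - fbar wA wZ f 1 * Hsl wA h 0 a)
            + g 1 0 a * ((2 - ρ 1 0) * Ysl wA f h 1 0 a - fbar wA wZ f 0 * Hsl wA h 0 a))
          + wZ 1 * (g 0 1 a * ((2 - ρ 0 1) * Ysl wA f h 0 1 a - fbar wA wZ f 1 * Hsl wA h 1 a)
            + g 1 1 a * ((2 - ρ 1 1) * Ysl wA f h 1 1 a - fbar wA wZ f 0 * Hsl wA h 1 a)))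
        - Gfun wZ g 0 a * (wZ 0 * ((1 - ρ 1 0) * Ysl wA f h 1 0 a) + wZ 1 * ((1 - ρ 1 1) * Ysl wA f h 1 1 a))
        - Gfun wZ g 1 a * (wZ 0 * ((1 - ρ 0 0) * Ysl wA f h 0 0 a) + wZ 1 * ((1 - ρ 0 1) * Ysl wA f h 0 1 a)) := by
      unfold PhiB; simp only [Fin.sum_univ_two]
    rw [e]
    linear_combination ih
/-- **THE c-POLARISED RATIO IDENTITY** `TL = Σ_b wB(b)Φ_B(b) + COV(ρ) + DELTA(ρ)` for EVERY ratio `ρ : Fin 2 → Fin 2 → ℝ`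
(pure bookkeeping; memo §2; `ρ ≡ 1` is `twoLevel_eq`). [this work] -/
theorem twoLevel_eq_ratio :
    twoLevel wA wB wZ f g h = (∑ b, wB b * PhiB wA wZ f g h ρ b) + CovR wA wB wZ f g h ρ + DeltaR wA wB wZ f g h ρ := by
  rw [sum_PhiB]
  unfold twoLevel CovR DeltaR psiR SGy fbar gbar hbar Sgy Sgh
  simp only [Fin.sum_univ_two]
  ring
omit [Fintype β] in
/-- `G_j` is monotone in `b` and nonnegative. [this work] -/
theorem Gfun_mono [Preorder β] (hZ : ∀ z, 0 ≤ wZ z) (hgb : ∀ j z, Monotone (g j z)) (j : Fin 2) :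
    Monotone (Gfun wZ g j) := by
  intro b b' hbb
  unfold Gfun
  exact sum_le_sum fun z _ => mul_le_mul_of_nonneg_left (hgb j z hbb) (hZ z)
/-- `E_b G_j = ḡ_j`. [this work] -/
theorem sum_Gfun (j : Fin 2) : (∑ b, wB b * Gfun wZ g j b) = gbar wB wZ g j := by
  have h1 := sum_Gfun_mul (wB := wB) (wZ := wZ) (g := g) j (fun _ => (1 : ℝ)) univ
  simp only [mul_one] at h1
  rw [h1]; unfold gbar gm; rw [Fin.sum_univ_two]
/-- **`COV(ρ) ≥ 0` for `ρ ∈ [0,1]`** (FKG on `β`). [this work] -/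
theorem CovR_nonneg [DistribLattice β] (hB : IsFKGMeasure wB) (hA0 : ∀ a, 0 ≤ wA a) (hZ : ∀ z, 0 ≤ wZ z)
    (hf0 : ∀ i z a, 0 ≤ f i z a) (hg0 : ∀ j z b, 0 ≤ g j z b) (hgb : ∀ j z, Monotone (g j z))
    (hh0 : ∀ z a b, 0 ≤ h z a b) (hhb : ∀ z a, Monotone (fun b => h z a b))
    (hρ0 : ∀ i z, 0 ≤ ρ i z) (hρ1 : ∀ i z, ρ i z ≤ 1) :
    0 ≤ CovR wA wB wZ f g h ρ := by
  have hYm := Ysl_mono (f := f) (h := h) hA0 hf0 hhb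
  have hY0 : ∀ i z b, 0 ≤ Ysl wA f h i z b := fun i z b =>
    sum_nonneg fun a _ => mul_nonneg (hA0 a) (mul_nonneg (hf0 i z a) (hh0 z a b))
  have hG0 : ∀ j b, 0 ≤ Gfun wZ g j b := fun j b => sum_nonneg fun z _ => mul_nonneg (hZ z) (hg0 j z b)
  have own : ∀ i z, 0 ≤ Sgy wA wB f g h i i z - gm wB g i z * Ybar wA wB f h i z := fun i z => by
    unfold Sgy gm Ybar
    exact sub_nonneg.2 (fkg_sum hB (hg0 i z) (hY0 i z) (hgb i z) (hYm i z))
  have cross : ∀ j i z, 0 ≤ SGy wA wB wZ f g h j i z - gbar wB wZ g j * Ybar wA wB f h i z := fun j i z => by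
    unfold SGy Ybar; rw [← sum_Gfun (wB := wB) (wZ := wZ) (g := g) j]
    exact sub_nonneg.2 (fkg_sum hB (hG0 j) (hY0 i z) (Gfun_mono hZ hgb j) (hYm i z))
  unfold CovR
  refine sum_nonneg fun z _ => mul_nonneg (hZ z) ?_
  have t1 := mul_nonneg (hρ0 0 z) (own 0 z); have t2 := mul_nonneg (sub_nonneg.2 (hρ1 0 z)) (cross 1 0 z)
  have t3 := mul_nonneg (hρ0 1 z) (own 1 z); have t4 := mul_nonneg (sub_nonneg.2 (hρ1 1 z)) (cross 0 1 z)
  linarith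
/-- **THEOREM B FOR THE HUB TWO-LEVEL FORM (certificate form).**  If some ratio `ρ ∈ [0,1]^{2×2}` makes the pointwise kernel `Φ_B(b)`
nonnegative at every fibre and `DELTA(ρ) ≥ 0`, then `TL ≥ 0` (hence `B ≥ 0` and T₁(|C|=1) for these data, memo §0).  Memo §3–§4: such a `ρ`
exists in every sampled cell and on the whole sampled environment polytope (the open finite-dimensional statement (ENV-LP)). [this work] -/
theorem twoLevel_nonneg_of_ratio [DistribLattice β] (hB : IsFKGMeasure wB) (hA0 : ∀ a, 0 ≤ wA a) (hZ : ∀ z, 0 ≤ wZ z)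
    (hf0 : ∀ i z a, 0 ≤ f i z a) (hg0 : ∀ j z b, 0 ≤ g j z b) (hgb : ∀ j z, Monotone (g j z))
    (hh0 : ∀ z a b, 0 ≤ h z a b) (hhb : ∀ z a, Monotone (fun b => h z a b))
    (hρ0 : ∀ i z, 0 ≤ ρ i z) (hρ1 : ∀ i z, ρ i z ≤ 1)
    (hPhi : ∀ b, 0 ≤ PhiB wA wZ f g h ρ b) (hDelta : 0 ≤ DeltaR wA wB wZ f g h ρ) :
    0 ≤ twoLevel wA wB wZ f g h := by
  rw [twoLevel_eq_ratio (ρ := ρ)]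
  have h1 : 0 ≤ ∑ b, wB b * PhiB wA wZ f g h ρ b := sum_nonneg fun b _ => mul_nonneg (hB.nonneg b) (hPhi b)
  have h2 := CovR_nonneg (f := f) hB hA0 hZ hf0 hg0 hgb hh0 hhb hρ0 hρ1
  linarith
end Main
end SahiHubTwoLevel
end Summit.CriticalPhenomena.PercolationContinuityZ3.Theorems
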